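import Summits.QuantumAdvantage.QuantumAdvantage.Theorems.LinnikCubicClassGroupsDegreeOnePrimesEscapeClassPNTTZFormPi
import Summits.QuantumAdvantage.QuantumAdvantage.Theorems.LinnikCubicClassGroupsDegreeOnePrimesEscapeLowerShadow
import Literature.NumberTheory.LFunctions.ClassGroupLFunctionNoExceptionalZeroOddDegree
import Literature.NumberTheory.LFunctions.LogIntegralStrictMonoProofs
import HarnessLib

/-!
# Thorner–Zaman (2019) Thm 1.4 in ODD degree: the class prime number theorem with decaying error and
# NO Landau–Siegel term (every cubic field)

Topic `Summits/QuantumAdvantage/QuantumAdvantage/Theorems`, cell B2b-1 (linnik-cubic), PART A (gen 32);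
helper toward the crux `DegreeOnePrimesEscape` (stmt-QuantumAdvantage-11543) of route
`LinnikCubicClassGroups`.  HONEST FRAMING: the value of this file is a THEOREM (kernel-checked, GRH-free,
Siegel-free) — NOT summit progress (the route still rests on the hypothesis-type target
`PureCubicClassNumberHard`).

`classPNT_TZ_of_odd (n) (hn : 1 < n) (hodd : Odd n)`: for the number fields `K` of one ODD degree `n`
(in particular every cubic field), with `Q = |d_K| n^n`, `h = h_K`: there are `c₁, c₂, c₃ > 0` depending
on `n` only such that for every class `C ∈ Cl(K)` and every `x ≥ Q^{c₁}`

  `|π_C(x) − Li(x)/h| ≤ c₃ (e^{−c₂ log x/log Q} + e^{−(c₂ log x)^{1/2}/n^{1/2}}) · Li(x)/h`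

— NO exceptional term, for ALL `x` beyond the Linnik range, with decaying relative error.  Proof: the
per-degree `π_C`-form `classPNT_TZ_dichotomy` (`…ClassPNTTZFormPi.lean`); in odd degree a real zero `β₁` of a
real class group character has `1 − β₁ > 1/(8·(2n)!·log|d_K|)` (`classGroupLFunction_ne_zero_of_odd`: Stark for
the quadratic class field, `…NoExceptionalZeroOddDegree.lean`), so the Landau–Siegel term
`Li(x^{β₁}) ≤ 3 x^{−(1−β₁)} Li(x) ≤ 3 e^{−log x/(8(2n)! log Q)} Li(x)` is part of the error
(`c₂ ≤ 1/(8·(2n)!)`).  This sharpens `classPNT_eps_of_odd` (`…ClassPNTNoExceptional.lean`, gen 4: fixed `ε`).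

References: J. Thorner, A. Zaman, Algebra Number Theory 13 (2019), Thm. 1.4 [ThornerZaman2019];
H. M. Stark, Invent. Math. 23 (1974), Thm. 3 [Stark1974].
-/

noncomputable section

open scoped NumberField
open Real MeasureTheory Set NumberField

namespace Summit.QuantumAdvantage.QuantumAdvantage.Theorems.DegreeOnePrimesEscape

open Literature.NumberTheory.LFunctions Literature.NumberTheory.LFunctions.NumberField

set_option maxHeartbeats 800000 in
/-- **The class prime number theorem with decaying error and no Landau–Siegel term, for every number
field of a fixed ODD degree** (see the module docstring). [cite: ThornerZaman2019, Theorem 1.4]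
[cite: Stark1974, Theorem 3] -/
theorem classPNT_TZ_of_odd (n : ℕ) (hn : 1 < n) (hodd : Odd n) :
    ∃ c₁ c₂ c₃ : ℝ, 0 < c₁ ∧ 0 < c₂ ∧ 0 < c₃ ∧
    ∀ (K : Type) [Field K] [NumberField K], Module.finrank ℚ K = n →
      ∀ (C : ClassGroup (𝓞 K)) (x : ℝ), ThornerZaman.condQn K ^ c₁ ≤ x →
        |(primeIdealClassCount K C x : ℝ) - offsetLogIntegral x / NumberField.classNumber K| ≤
          c₃ * ThornerZaman.errorTermN c₂ (ThornerZaman.condQn K) n x *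
            (offsetLogIntegral x / NumberField.classNumber K) := by
  classical
  obtain ⟨c₁, c₂, c₃, hc₁, hc₂, hc₃, H⟩ := classPNT_TZ_dichotomy n hn
  set cS : ℝ := 1 / (8 * ((2 * n).factorial : ℝ)) with hcS
  have hfac0 : (0 : ℝ) < ((2 * n).factorial : ℝ) := by exact_mod_cast Nat.factorial_pos _
  have hcS0 : 0 < cS := by positivity
  refine ⟨max c₁ 40, min c₂ cS, 4 * c₃ + 3, by positivity, lt_min hc₂ hcS0, by positivity,
    fun K _ _ hKn C x hx ↦ ?_⟩
  have hK : 1 < Module.finrank ℚ K := by rw [hKn]; exact hn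
  have hHK := H K hKn
  set Q : ℝ := ThornerZaman.condQn K with hQ
  have hQ12 : (12 : ℝ) ≤ Q := ThornerZaman.twelve_le_condQn (K := K) hK
  have hQ1 : (1 : ℝ) < Q := by linarith
  have hQ0 : (0 : ℝ) < Q := by linarith
  have hlogQ : 2 ≤ Real.log Q := two_lt_log_twelve.le.trans (Real.log_le_log (by norm_num) hQ12)
  have hlogQ0 : 0 < Real.log Q := by linarith
  set h : ℝ := (NumberField.classNumber K : ℝ) with hh
  have hh1 : 1 ≤ h := by rw [hh]; exact_mod_cast one_le_classNumber (K := K)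
  have hh0 : 0 < h := by linarith
  -- the range
  have hxc₁ : Q ^ c₁ ≤ x := (Real.rpow_le_rpow_of_exponent_le hQ1.le (le_max_left _ _)).trans hx
  have hx40 : Q ^ (40 : ℝ) ≤ x := (Real.rpow_le_rpow_of_exponent_le hQ1.le (le_max_right _ _)).trans hx
  have hxQ : Q ≤ x := by
    have : Q ^ (1 : ℝ) ≤ Q ^ (40 : ℝ) := Real.rpow_le_rpow_of_exponent_le hQ1.le (by norm_num)
    rw [Real.rpow_one] at this; linarith
  have hx1 : 1 < x := by linarith
  have hx0 : 0 < x := by linarith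
  have hL80 : 80 ≤ Real.log x := by
    have := Real.log_le_log (by positivity) hx40
    rw [Real.log_rpow hQ0] at this; nlinarith
  have hx256 : (256 : ℝ) ≤ x := by
    have h1 : Real.log 256 ≤ Real.log x := by
      have : Real.log 256 = 8 * Real.log 2 := by
        rw [show (256 : ℝ) = 2 ^ 8 by norm_num, Real.log_pow]; norm_num
      linarith [Real.log_two_lt_d9]
    exact (Real.log_le_log_iff (by norm_num) hx0).mp h1
  -- error terms
  set E : ℝ := ThornerZaman.errorTermN c₂ Q n x with hE
  set E' : ℝ := ThornerZaman.errorTermN (min c₂ cS) Q n x with hE'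
  have hEE' : E ≤ E' := ThornerZaman.errorTermN_le_of_le (min_le_left _ _) hQ1 n hx1.le
  have hE'0 : 0 < E' := ThornerZaman.errorTermN_pos _ _ _ _
  have hE0 : 0 < E := ThornerZaman.errorTermN_pos _ _ _ _
  have hLi : x / (2 * Real.log x) ≤ offsetLogIntegral x := div_two_mul_log_le_offsetLogIntegral hx256
  have hLi0 : 0 ≤ offsetLogIntegral x := le_trans (by positivity) hLi
  rcases hHK with ⟨-, hA⟩ | ⟨χ₁, β₁, hreal, hwin, hβ1, hL0, hB⟩
  · -- no real zero in the window
    have h1 := hA C x hxc₁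
    refine h1.trans ?_
    have : c₃ * E * (offsetLogIntegral x / h) ≤ (4 * c₃ + 3) * E' * (offsetLogIntegral x / h) := by
      have hq : 0 ≤ offsetLogIntegral x / h := div_nonneg hLi0 hh0.le
      have h2 : c₃ * E ≤ (4 * c₃ + 3) * E' := by nlinarith
      exact mul_le_mul_of_nonneg_right h2 hq
    exact this
  · -- a real zero `β₁` in the window: by Stark (odd degree) it is far from `1`
    have hodd' : Odd (Module.finrank ℚ K) := by rw [hKn]; exact hodd
    have hfar : β₁ < 1 - 1 / (8 * ((2 * Module.finrank ℚ K).factorial : ℝ) *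
        Real.log ((NumberField.discr K).natAbs : ℝ)) := by
      by_contra hge
      rw [not_lt] at hge
      exact classGroupLFunction_ne_zero_of_odd K hodd' hK χ₁ hreal hge hβ1 hL0
    rw [hKn] at hfar
    -- `log|d_K| ≤ log Q`, `log|d_K| > 0`
    have hd3 : (3 : ℝ) ≤ ((NumberField.discr K).natAbs : ℝ) := by
      have h2 := NumberField.abs_discr_gt_two hK
      rw [Nat.cast_natAbs]
      exact_mod_cast (show (3 : ℤ) ≤ |NumberField.discr K| by omega)
    have hlogd : 0 < Real.log ((NumberField.discr K).natAbs : ℝ) := Real.log_pos (by linarith)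
    have hlogdQ : Real.log ((NumberField.discr K).natAbs : ℝ) ≤ Real.log Q :=
      Real.log_le_log (by linarith) (natAbs_discr_le_condQn K)
    have hδ : cS / Real.log Q ≤ 1 - β₁ := by
      have h1 : cS / Real.log Q ≤ cS / Real.log ((NumberField.discr K).natAbs : ℝ) :=
        div_le_div_of_nonneg_left hcS0.le hlogd hlogdQ
      have h2 : cS / Real.log ((NumberField.discr K).natAbs : ℝ) =
          1 / (8 * ((2 * n).factorial : ℝ) * Real.log ((NumberField.discr K).natAbs : ℝ)) := by
        rw [hcS]; field_simp
      linarith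
    have hβ34 : 3 / 4 ≤ β₁ := by
      have : 1 / (8 * Real.log Q) ≤ 1 / 16 := by
        rw [div_le_div_iff_of_pos_left one_pos (by positivity) (by norm_num)]; linarith
      linarith
    have hβ0 : 0 < β₁ := by linarith
    -- `Li(x^β₁) ≤ 3 e^{-(1-β₁) log x} Li(x) ≤ 3 E' Li(x)`
    have hxβ : x ^ β₁ = x * Real.exp (-((1 - β₁) * Real.log x)) := by
      rw [Real.rpow_def_of_pos hx0, show Real.log x * β₁ = Real.log x + -((1 - β₁) * Real.log x) by ring,
        Real.exp_add, Real.exp_log hx0]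
    have hlogxβ : Real.log (x ^ β₁) = β₁ * Real.log x := by
      rw [Real.log_rpow hx0]
    have hy60 : Real.exp 60 ≤ x ^ β₁ := by
      rw [← Real.exp_log (Real.rpow_pos_of_pos hx0 β₁), Real.exp_le_exp, hlogxβ]
      nlinarith
    have hLiβ := Dock.offsetLogIntegral_le_mul_div_log hy60
    have hexpE : Real.exp (-((1 - β₁) * Real.log x)) ≤ E' := by
      refine le_trans (Real.exp_le_exp.2 ?_) (ThornerZaman.exp_le_errorTermN (min c₂ cS) Q n x)
      rw [neg_le_neg_iff]
      have h1 : min c₂ cS * Real.log x / Real.log Q ≤ cS * Real.log x / Real.log Q :=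
        div_le_div_of_nonneg_right (mul_le_mul_of_nonneg_right (min_le_right _ _) (by linarith)) hlogQ0.le
      have h2 : cS * Real.log x / Real.log Q = cS / Real.log Q * Real.log x := by ring
      have h3 : cS / Real.log Q * Real.log x ≤ (1 - β₁) * Real.log x :=
        mul_le_mul_of_nonneg_right hδ (by linarith)
      linarith
    have hLiβ' : offsetLogIntegral (x ^ β₁) ≤ 3 * E' * offsetLogIntegral x := by
      -- `Li(x^β) ≤ (26/25) x^β/(β log x) ≤ (26/25)(4/3) e^{-(1-β)L} (x/log x) ≤ 3 e^{-(1-β)L} Li x`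
      have hL0 : 0 < Real.log x := by linarith
      have h1 : x ^ β₁ / Real.log (x ^ β₁) ≤ 4 / 3 * (Real.exp (-((1 - β₁) * Real.log x)) * (x / Real.log x)) := by
        rw [hlogxβ, hxβ, div_le_iff₀ (by positivity)]
        have hq : 0 ≤ Real.exp (-((1 - β₁) * Real.log x)) * (x / Real.log x) * (β₁ * Real.log x) := by
          positivity
        have e : Real.exp (-((1 - β₁) * Real.log x)) * (x / Real.log x) * (β₁ * Real.log x) =
            β₁ * (x * Real.exp (-((1 - β₁) * Real.log x))) := by field_simp
        nlinarith
      have h2 : x / Real.log x ≤ 2 * offsetLogIntegral x := by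
        have e : 2 * (x / (2 * Real.log x)) = x / Real.log x := by
          rw [← mul_div_assoc, mul_div_mul_left x (Real.log x) two_ne_zero]
        rw [← e]; linarith
      have h3 : Real.exp (-((1 - β₁) * Real.log x)) * (x / Real.log x) ≤ E' * (2 * offsetLogIntegral x) :=
        mul_le_mul hexpE h2 (by positivity) hE'0.le
      nlinarith
    have hLiβ0 : 0 ≤ offsetLogIntegral (x ^ β₁) := by
      have hy256 : (256 : ℝ) ≤ x ^ β₁ := by
        refine le_trans ?_ hy60
        have := Real.quadratic_le_exp_of_nonneg (by norm_num : (0 : ℝ) ≤ 60); nlinarith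
      exact le_trans (by have := Real.log_pos (by linarith : (1:ℝ) < x ^ β₁); positivity)
        (div_two_mul_log_le_offsetLogIntegral hy256)
    -- the main term with and without the exceptional zero
    have hr := abs_re_classGroupChar_apply_le hreal C
    set r : ℝ := ((χ₁ C : ℂ)).re with hrdef
    set G : ℝ := offsetLogIntegral x - r * offsetLogIntegral (x ^ β₁) with hG
    have h1 := hB C x hxc₁
    have hrLi : |r * offsetLogIntegral (x ^ β₁)| ≤ offsetLogIntegral (x ^ β₁) := by
      rw [abs_mul, abs_of_nonneg hLiβ0]
      calc |r| * offsetLogIntegral (x ^ β₁) ≤ 1 * offsetLogIntegral (x ^ β₁) :=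
            mul_le_mul_of_nonneg_right hr hLiβ0
        _ = _ := one_mul _
    have hG4 : G ≤ 4 * offsetLogIntegral x := by
      have := (abs_le.1 hrLi).1
      -- `Li(x^β₁) ≤ Li(x)` by monotonicity
      have hsm : StrictMonoOn offsetLogIntegral (Set.Ioi 1) := strictMonoOn_offsetLogIntegral_holds
      have hxβ1 : 1 < x ^ β₁ := by
        have := Real.add_one_le_exp (60 : ℝ); linarith
      have hxβx : x ^ β₁ ≤ x := by
        have := Real.rpow_le_rpow_of_exponent_le hx1.le hβ1.le
        rwa [Real.rpow_one] at this
      have hLimono : offsetLogIntegral (x ^ β₁) ≤ offsetLogIntegral x :=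
        hsm.monotoneOn (Set.mem_Ioi.2 hxβ1) (Set.mem_Ioi.2 hx1) hxβx
      rw [hG]; linarith
    have hG0 : 0 ≤ G := by
      -- from `h1`: `0 ≤ |…| ≤ c₃ E G/h`, `c₃ E > 0`, `h > 0`
      have hAE : 0 < c₃ * E := mul_pos hc₃ hE0
      have : 0 ≤ c₃ * E * (G / h) := (abs_nonneg _).trans h1
      have hq : 0 ≤ G / h := le_of_mul_le_mul_left (by rw [mul_zero]; exact this) hAE
      have := mul_nonneg hq hh0.le
      rwa [div_mul_cancel₀ _ hh0.ne'] at this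
    -- assemble
    have hsplit : |(primeIdealClassCount K C x : ℝ) - offsetLogIntegral x / h| ≤
        |(primeIdealClassCount K C x : ℝ) - G / h| + offsetLogIntegral (x ^ β₁) / h := by
      have e : (primeIdealClassCount K C x : ℝ) - offsetLogIntegral x / h =
          ((primeIdealClassCount K C x : ℝ) - G / h) + (-(r * offsetLogIntegral (x ^ β₁))) / h := by
        rw [hG]; field_simp; ring
      rw [e]
      refine (abs_add_le _ _).trans (add_le_add le_rfl ?_)
      rw [abs_div, abs_of_pos hh0, abs_neg]
      exact div_le_div_of_nonneg_right hrLi hh0.le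
    refine hsplit.trans ?_
    have hineq : c₃ * E * G + offsetLogIntegral (x ^ β₁) ≤ (4 * c₃ + 3) * E' * offsetLogIntegral x := by
      have a1 : c₃ * E * G ≤ c₃ * E' * (4 * offsetLogIntegral x) :=
        mul_le_mul (mul_le_mul_of_nonneg_left hEE' hc₃.le) hG4 hG0 (by positivity)
      nlinarith
    calc |(primeIdealClassCount K C x : ℝ) - G / h| + offsetLogIntegral (x ^ β₁) / h
        ≤ c₃ * E * (G / h) + offsetLogIntegral (x ^ β₁) / h := add_le_add h1 le_rfl
      _ = (c₃ * E * G + offsetLogIntegral (x ^ β₁)) / h := by ring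
      _ ≤ (4 * c₃ + 3) * E' * offsetLogIntegral x / h := div_le_div_of_nonneg_right hineq hh0.le
      _ = (4 * c₃ + 3) * E' * (offsetLogIntegral x / h) := by ring

/-- **Every cubic field**: the class prime number theorem `|π_C(x) − Li(x)/h_K| ≤ c₃ E(x) Li(x)/h_K` for all
classes `C` and all `x ≥ (27|d_K|)^{c₁}`, with decaying `E(x) = e^{−c₂ log x/log(27|d_K|)} + e^{−(c₂ log x/3)^{1/2}}`
and NO Landau–Siegel term (`classPNT_TZ_of_odd 3`). [cite: ThornerZaman2019, Theorem 1.4] [cite: Stark1974, Theorem 3] -/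
theorem classPNT_TZ_cubic :
    ∃ c₁ c₂ c₃ : ℝ, 0 < c₁ ∧ 0 < c₂ ∧ 0 < c₃ ∧
    ∀ (K : Type) [Field K] [NumberField K], Module.finrank ℚ K = 3 →
      ∀ (C : ClassGroup (𝓞 K)) (x : ℝ), ThornerZaman.condQn K ^ c₁ ≤ x →
        |(primeIdealClassCount K C x : ℝ) - offsetLogIntegral x / NumberField.classNumber K| ≤
          c₃ * ThornerZaman.errorTermN c₂ (ThornerZaman.condQn K) 3 x *
            (offsetLogIntegral x / NumberField.classNumber K) :=
  classPNT_TZ_of_odd 3 (by norm_num) (by decide)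

end Summit.QuantumAdvantage.QuantumAdvantage.Theorems.DegreeOnePrimesEscape

end
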